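import Literature.Analysis.Matrix.LogDetMixedDifferenceExpLocalised
import HarnessLib

/-!
# The mixed second difference of `log det`, III: the LOCALLY SUMMED edition (no `Fintype.card` prefactors)

Topic `Literature/Analysis/Matrix`; namespace `Literature.Analysis.Matrix`.  Sequel of `LogDetMixedDifference.lean` (block-supported
variations, `abs_fourPt_log_det_le`) and `LogDetMixedDifferenceExpLocalised.lean` (exponentially localised variations,
`abs_fourPt_log_det_le_of_expLocalised`).  Everything here is PROVED; no definitions, no named facts.

THE POINT.  `abs_trace_mul4_le_of_expLocalised` ∕ `abs_fourPt_log_det_le_of_expLocalised` bound the four-index sum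
`Σ_{a,b,c,x} |A a b|·|E b c|·|B c x|·|D x a|` TERMWISE and then count the terms, so their conclusions carry `|n|⁴` (and `|n|²` for the
mixed-response term).  In the application (`n` = fine bonds × Lie-algebra basis of a lattice gauge theory, `|n| ~ L^{3K}`) such prefactors
are not uniform in the depth `K`.  Print's bound is uniform because the trace is summed LOCALLY: the two variations are not only small
far from their bonds, they are SUMMABLE.  This file replaces the pointwise profile rows by ROW∕COLUMN-SUMMED profile rows and the
counting by two local sums:

* §1 `abs_trace_mul4_le_sum_rowCol` — `|tr(A E B D)| ≤ β·Σ_a Σ_b |A a b|·(Σ_c |E b c|)·(Σ_x |D x a|)` for `|B| ≤ β`;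
  ★`abs_trace_mul4_le_of_summedProfiles` — with `|A a b| ≤ α·e^{−θ·dist a b}`, COLUMN sums `Σ_x |D x a| ≤ δ·e^{−θ·d a}`, ROW sums
  `Σ_c |E b c| ≤ ε·e^{−θ·d′ b}`, separation `R ≤ d a + dist a b + d′ b`, and, for some `0 ≤ θ₂ ≤ θ`, the LOCAL SUMS
  `Σ_a e^{−θ₂·d a} ≤ S_d`, `Σ_b e^{−θ₂·dist a b} ≤ S_dist` (every `a`):  `|tr(A E B D)| ≤ α·ε·β·δ·S_d·S_dist·e^{−(θ−θ₂)R}`;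
  `abs_trace_mul_le_of_entry_le_of_sum_le` — `|tr(B R)| ≤ β₀·η` for `|B| ≤ β₀` and the ℓ¹ bound `Σ_{a,b} |R a b| ≤ η`.
* §2 ★★`abs_fourPt_log_det_le_of_summedProfiles` — the rectangle theorem of the two prequels with these rows:
  `|Δ² log det| ≤ α·ε·β₀·δ·S_d·S_dist·e^{−(θ−θ₂)R} + β₀·η` — NO `Fintype.card n`.
* §3 ★`abs_fourPt_log_det_le_of_expLocalised_range` — the prequel's POINTWISE profile rows plus a
  finite RANGE `r` of the two variations (w.r.t. `dist`) and a bound `V` on the cardinality of `dist`-balls of radius `r` give the summed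
  rows with `δ·V`, `ε·V`; so the prequel's hypotheses + range + ball volume ⟹ the card-free bound.
* §4 ★`sum_sum_abs_le_of_twoProfile_range` — the ℓ¹ mixed-response row from a TWO-PROFILE pointwise row `|H a b| ≤ η₀·e^{−θ·(d a + d′ a)}` +
  range + ball count: `Σ_{a,b} |H a b| ≤ η₀·V·S_d·e^{−(θ−θ₂)·R}`; ★★`abs_fourPt_log_det_le_of_expLocalised_range₂` — the rectangle with EVERY
  row pointwise and EVERY constant local: `|Δ² log det| ≤ (α·ε·δ·V²·S_dist + η₀·V)·β₀·S_d·e^{−(θ−θ₂)·R}` (written as a sum of the two terms).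

Consumer (cell `ym3-torus`, crux `FluctuationComparisonRegPrIntL`, LINE «semiclassical S2β», residue FOUR-POINT-DECAY): a depth-uniform
`φ₁` in the one-loop clustering bound (memo LOCATE-DECAY §4).  In d = 3 the local sums are `O(θ₂⁻³)` uniformly in the lattice size.
HONEST SCOPE: finite-dimensional linear algebra and one FTC (inherited); nothing here bears on the Yang–Mills mass gap (Clay), which is NOT
proved.

References: T. Bałaban, CMP 102 (1985) 277, Thm 1 (10) p. 279 [Balaban1985Variational]; J. Glimm, A. Jaffe, *Quantum Physics* (1987) §18.2
[GlimmJaffe1987]; M. Aizenman, S. Warzel, *Random Operators* (2015) §10.3 [AizenmanWarzel2015]; R. A. Horn, C. R. Johnson, *Matrix Analysis*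
(2013) §5.6, §0.8.10 [HornJohnson2013].
-/

noncomputable section

open Matrix Finset MeasureTheory intervalIntegral
open scoped Matrix

namespace Literature.Analysis.Matrix

variable {n : Type*} [Fintype n] [DecidableEq n]

/-! ## §1 Trace bounds with row∕column-summed profiles -/

omit [DecidableEq n] in
/-- `|tr(A E B D)| ≤ β·Σ_a Σ_b |A a b|·(Σ_c |E b c|)·(Σ_x |D x a|)` when `|B c x| ≤ β`: the `c`- and `x`-sums are kept as sums (to be
bounded by ROW sums of `E` and COLUMN sums of `D`), not counted. [cite: HornJohnson2013, §5.6 (entrywise estimates)] -/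
theorem abs_trace_mul4_le_sum_rowCol (A E B D : Matrix n n ℝ) {β : ℝ} (hB : ∀ c x, |B c x| ≤ β) :
    |(A * E * B * D).trace| ≤ β * ∑ a, ∑ b, |A a b| * (∑ c, |E b c|) * (∑ x, |D x a|) := by
  refine (abs_trace_mul4_le_sum A E B D).trans ?_
  have hterm : ∀ a b c x, |A a b| * |E b c| * |B c x| * |D x a| ≤ β * (|A a b| * |E b c| * |D x a|) := by
    intro a b c x
    have h0 : 0 ≤ |A a b| * |E b c| * |D x a| := by positivity
    calc |A a b| * |E b c| * |B c x| * |D x a| = |B c x| * (|A a b| * |E b c| * |D x a|) := by ring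
      _ ≤ β * (|A a b| * |E b c| * |D x a|) := mul_le_mul_of_nonneg_right (hB c x) h0
  have key : ∀ a b, ∑ c, ∑ x, β * (|A a b| * |E b c| * |D x a|) = β * (|A a b| * (∑ c, |E b c|) * (∑ x, |D x a|)) := by
    intro a b
    rw [mul_assoc (|A a b|), Finset.sum_mul_sum, Finset.mul_sum, Finset.mul_sum]
    refine Finset.sum_congr rfl fun c _ => ?_
    rw [Finset.mul_sum, Finset.mul_sum]
    refine Finset.sum_congr rfl fun x _ => ?_
    ring
  calc ∑ a, ∑ b, ∑ c, ∑ x, |A a b| * |E b c| * |B c x| * |D x a|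
      ≤ ∑ a, ∑ b, ∑ c, ∑ x, β * (|A a b| * |E b c| * |D x a|) :=
        Finset.sum_le_sum fun a _ => Finset.sum_le_sum fun b _ => Finset.sum_le_sum fun c _ =>
          Finset.sum_le_sum fun x _ => hterm a b c x
    _ = ∑ a, ∑ b, β * (|A a b| * (∑ c, |E b c|) * (∑ x, |D x a|)) :=
        Finset.sum_congr rfl fun a _ => Finset.sum_congr rfl fun b _ => key a b
    _ = β * ∑ a, ∑ b, |A a b| * (∑ c, |E b c|) * (∑ x, |D x a|) := by
        rw [Finset.mul_sum]
        exact Finset.sum_congr rfl fun a _ => (Finset.mul_sum _ _ _).symm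

omit [DecidableEq n] in
/-- ★ **The four-factor trace bound with SUMMED profiles (no `Fintype.card`).**  `A` decays off the diagonal at rate `θ` in the
pseudo-distance `dist` (`|A a b| ≤ α·e^{−θ·dist a b}` — Combes–Thomas), `|B| ≤ β`, the COLUMN sums of `D` follow the profile `d`
(`Σ_x |D x a| ≤ δ·e^{−θ·d a}`), the ROW sums of `E` the profile `d′` (`Σ_c |E b c| ≤ ε·e^{−θ·d′ b}`), the profiles are `R` apart through `dist`
(`R ≤ d a + dist a b + d′ b`), and for some `0 ≤ θ₂ ≤ θ` the local sums are `Σ_a e^{−θ₂·d a} ≤ S_d`, `Σ_b e^{−θ₂·dist a b} ≤ S_dist` (all `a`),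
`0 ≤ S_dist`.  Then `|tr(A E B D)| ≤ α·ε·β·δ·S_d·S_dist·e^{−(θ−θ₂)·R}`: the rate `θ − θ₂` goes to the separation, `θ₂` to summability.
[cite: AizenmanWarzel2015, §10.3] [cite: HornJohnson2013, §5.6] -/
theorem abs_trace_mul4_le_of_summedProfiles (dist : n → n → ℕ) {A E B D : Matrix n n ℝ}
    {α ε β δ θ θ₂ Sd Sdist : ℝ} (hα : 0 ≤ α) (hε : 0 ≤ ε) (hβ : 0 ≤ β) (hδ : 0 ≤ δ)
    (hθ₂ : 0 ≤ θ₂) (hθ₂θ : θ₂ ≤ θ) (hSdist0 : 0 ≤ Sdist)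
    (hA : ∀ a b, |A a b| ≤ α * Real.exp (-(θ * dist a b))) (hB : ∀ c x, |B c x| ≤ β)
    {d d' : n → ℕ} (hD : ∀ a, ∑ x, |D x a| ≤ δ * Real.exp (-(θ * d a)))
    (hE : ∀ b, ∑ c, |E b c| ≤ ε * Real.exp (-(θ * d' b)))
    {R : ℕ} (hsep : ∀ a b, R ≤ d a + dist a b + d' b)
    (hSd : ∑ a, Real.exp (-(θ₂ * d a)) ≤ Sd) (hSdi : ∀ a, ∑ b, Real.exp (-(θ₂ * dist a b)) ≤ Sdist) :
    |(A * E * B * D).trace| ≤ α * ε * β * δ * Sd * Sdist * Real.exp (-((θ - θ₂) * R)) := by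
  refine (abs_trace_mul4_le_sum_rowCol A E B D hB).trans ?_
  -- the exponent bookkeeping: `θ(d + dist + d′) ≥ (θ − θ₂)R + θ₂ d + θ₂ dist`
  have hexp : ∀ a b, Real.exp (-(θ * dist a b)) * Real.exp (-(θ * d' b)) * Real.exp (-(θ * d a)) ≤
      Real.exp (-((θ - θ₂) * R)) * (Real.exp (-(θ₂ * d a)) * Real.exp (-(θ₂ * dist a b))) := by
    intro a b
    rw [← Real.exp_add, ← Real.exp_add, ← Real.exp_add, ← Real.exp_add]
    refine Real.exp_le_exp.2 ?_
    have h : (R : ℝ) ≤ d a + dist a b + d' b := by exact_mod_cast hsep a b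
    have h1 : (0 : ℝ) ≤ d' b := Nat.cast_nonneg _
    have h2 : (0 : ℝ) ≤ d a := Nat.cast_nonneg _
    have h3 : (0 : ℝ) ≤ dist a b := Nat.cast_nonneg _
    have h4 : 0 ≤ θ - θ₂ := sub_nonneg.2 hθ₂θ
    nlinarith [mul_le_mul_of_nonneg_left h h4, mul_nonneg hθ₂ h1]
  -- termwise bound for fixed `a, b`
  have hterm : ∀ a b, |A a b| * (∑ c, |E b c|) * (∑ x, |D x a|) ≤
      α * ε * δ * Real.exp (-((θ - θ₂) * R)) * (Real.exp (-(θ₂ * d a)) * Real.exp (-(θ₂ * dist a b))) := by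
    intro a b
    have h0A : 0 ≤ α * Real.exp (-(θ * dist a b)) := by positivity
    have h0E : 0 ≤ ε * Real.exp (-(θ * d' b)) := by positivity
    have hEn : 0 ≤ ∑ c, |E b c| := Finset.sum_nonneg fun c _ => abs_nonneg _
    have hDn : 0 ≤ ∑ x, |D x a| := Finset.sum_nonneg fun x _ => abs_nonneg _
    calc |A a b| * (∑ c, |E b c|) * (∑ x, |D x a|)
        ≤ (α * Real.exp (-(θ * dist a b))) * (ε * Real.exp (-(θ * d' b))) * (δ * Real.exp (-(θ * d a))) := by
          have h1 := hA a b
          have h2 := hE b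
          have h3 := hD a
          gcongr
      _ = α * ε * δ * (Real.exp (-(θ * dist a b)) * Real.exp (-(θ * d' b)) * Real.exp (-(θ * d a))) := by ring
      _ ≤ α * ε * δ * (Real.exp (-((θ - θ₂) * R)) * (Real.exp (-(θ₂ * d a)) * Real.exp (-(θ₂ * dist a b)))) :=
          mul_le_mul_of_nonneg_left (hexp a b) (by positivity)
      _ = α * ε * δ * Real.exp (-((θ - θ₂) * R)) * (Real.exp (-(θ₂ * d a)) * Real.exp (-(θ₂ * dist a b))) := by ring
  -- sum over `b`, then over `a`
  have hb : ∀ a, ∑ b, |A a b| * (∑ c, |E b c|) * (∑ x, |D x a|) ≤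
      α * ε * δ * Real.exp (-((θ - θ₂) * R)) * (Real.exp (-(θ₂ * d a)) * Sdist) := by
    intro a
    calc ∑ b, |A a b| * (∑ c, |E b c|) * (∑ x, |D x a|)
        ≤ ∑ b, α * ε * δ * Real.exp (-((θ - θ₂) * R)) * (Real.exp (-(θ₂ * d a)) * Real.exp (-(θ₂ * dist a b))) :=
          Finset.sum_le_sum fun b _ => hterm a b
      _ = α * ε * δ * Real.exp (-((θ - θ₂) * R)) * (Real.exp (-(θ₂ * d a)) * ∑ b, Real.exp (-(θ₂ * dist a b))) := by
          rw [Finset.mul_sum, Finset.mul_sum]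
      _ ≤ α * ε * δ * Real.exp (-((θ - θ₂) * R)) * (Real.exp (-(θ₂ * d a)) * Sdist) := by
          have h := hSdi a
          have h0 : 0 ≤ α * ε * δ * Real.exp (-((θ - θ₂) * R)) := by positivity
          exact mul_le_mul_of_nonneg_left (mul_le_mul_of_nonneg_left h (Real.exp_pos _).le) h0
  have ha : ∑ a, ∑ b, |A a b| * (∑ c, |E b c|) * (∑ x, |D x a|) ≤
      α * ε * δ * Real.exp (-((θ - θ₂) * R)) * (Sd * Sdist) := by
    calc ∑ a, ∑ b, |A a b| * (∑ c, |E b c|) * (∑ x, |D x a|)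
        ≤ ∑ a, α * ε * δ * Real.exp (-((θ - θ₂) * R)) * (Real.exp (-(θ₂ * d a)) * Sdist) :=
          Finset.sum_le_sum fun a _ => hb a
      _ = α * ε * δ * Real.exp (-((θ - θ₂) * R)) * ((∑ a, Real.exp (-(θ₂ * d a))) * Sdist) := by
          rw [Finset.sum_mul, Finset.mul_sum]
      _ ≤ α * ε * δ * Real.exp (-((θ - θ₂) * R)) * (Sd * Sdist) := by
          have h0 : 0 ≤ α * ε * δ * Real.exp (-((θ - θ₂) * R)) := by positivity
          exact mul_le_mul_of_nonneg_left (mul_le_mul_of_nonneg_right hSd hSdist0) h0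
  calc β * ∑ a, ∑ b, |A a b| * (∑ c, |E b c|) * (∑ x, |D x a|)
      ≤ β * (α * ε * δ * Real.exp (-((θ - θ₂) * R)) * (Sd * Sdist)) := mul_le_mul_of_nonneg_left ha hβ
    _ = α * ε * β * δ * Sd * Sdist * Real.exp (-((θ - θ₂) * R)) := by ring

omit [DecidableEq n] in
/-- With a global entry bound `|B| ≤ β₀` and an ℓ¹ bound `Σ_{a,b} |R a b| ≤ η`: `|tr(B R)| ≤ β₀·η` (no `Fintype.card`; the edition of
`abs_trace_mul_le_of_entry_le` for a SUMMABLE second factor). [cite: HornJohnson2013, §5.6 (entrywise estimates)] -/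
theorem abs_trace_mul_le_of_entry_le_of_sum_le {B R : Matrix n n ℝ} {β₀ η : ℝ} (hβ₀ : 0 ≤ β₀) (hB : ∀ a b, |B a b| ≤ β₀)
    (hR : ∑ a, ∑ b, |R a b| ≤ η) : |(B * R).trace| ≤ β₀ * η := by
  refine (abs_trace_mul_le_sum B R).trans ?_
  calc ∑ a, ∑ b, |B a b| * |R b a| ≤ ∑ a, ∑ b, β₀ * |R b a| :=
        Finset.sum_le_sum fun a _ => Finset.sum_le_sum fun b _ => mul_le_mul_of_nonneg_right (hB a b) (abs_nonneg _)
    _ = β₀ * ∑ b, ∑ a, |R b a| := by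
        rw [Finset.sum_comm, Finset.mul_sum]
        exact Finset.sum_congr rfl fun b _ => (Finset.mul_sum _ _ _).symm
    _ ≤ β₀ * η := mul_le_mul_of_nonneg_left hR hβ₀

/-! ## §2 The rectangle with summed profiles: the card-free `Δ² log det` bound -/

/-- ★★ **`Δ² log det` OVER A RECTANGLE WITH LOCALLY SUMMED VARIATIONS (no `Fintype.card`).**  A two-parameter family `M(s,t)` of
invertible real matrices, entrywise C¹ in `s` at `t = 0, 1` (derivative `M′(s,t)`, continuous in `s`); the COLUMN sums of the
`s`-variation at `t = 1` follow the profile `d` (`Σ_x |M′(s,1) x a| ≤ δ·e^{−θ·d a}`), the ROW sums of the `t`-variation follow `d′`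
(`Σ_c |(M(s,1) − M(s,0)) b c| ≤ ε·e^{−θ·d′ b}`), the profiles are `R` apart through `dist` (`R ≤ d a + dist a b + d′ b`); Combes–Thomas decay
`|M(s,1)⁻¹ a b| ≤ α·e^{−θ·dist a b}`, global entries `|M(s,0)⁻¹| ≤ β₀`, ℓ¹ MIXED RESPONSE `Σ_{a,b} |(M′(s,1) − M′(s,0)) a b| ≤ η`; and, for
some `0 ≤ θ₂ ≤ θ`, LOCAL SUMS `Σ_a e^{−θ₂·d a} ≤ S_d`, `Σ_b e^{−θ₂·dist a b} ≤ S_dist` (every `a`), `0 ≤ S_dist`.  Then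
`|log det M(0,0) − log det M(1,0) − (log det M(0,1) − log det M(1,1))| ≤ α·ε·β₀·δ·S_d·S_dist·e^{−(θ−θ₂)·R} + β₀·η`.
This is `abs_fourPt_log_det_le_of_expLocalised` with the `|n|⁴`, `|n|²` prefactors replaced by the two local sums and the ℓ¹ response.
[cite: Balaban1985Variational, Thm 1 (10) p. 279] [cite: GlimmJaffe1987, §18.2] -/
theorem abs_fourPt_log_det_le_of_summedProfiles (dist : n → n → ℕ) {M M' : ℝ → ℝ → Matrix n n ℝ}
    (hM : ∀ t s i j, HasDerivAt (fun s => M s t i j) (M' s t i j) s) (hM'c : ∀ t i j, Continuous fun s => M' s t i j)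
    (hne : ∀ s t, (M s t).det ≠ 0)
    {α ε δ β₀ η θ θ₂ Sd Sdist : ℝ} (hα : 0 ≤ α) (hε : 0 ≤ ε) (hδ : 0 ≤ δ) (hβ₀ : 0 ≤ β₀)
    (hθ₂ : 0 ≤ θ₂) (hθ₂θ : θ₂ ≤ θ) (hSdist0 : 0 ≤ Sdist)
    {d d' : n → ℕ} (hD : ∀ s a, ∑ x, |M' s 1 x a| ≤ δ * Real.exp (-(θ * d a)))
    (hE : ∀ s b, ∑ c, |(M s 1 - M s 0) b c| ≤ ε * Real.exp (-(θ * d' b)))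
    {R : ℕ} (hsep : ∀ a b, R ≤ d a + dist a b + d' b)
    (hA : ∀ s a b, |(M s 1)⁻¹ a b| ≤ α * Real.exp (-(θ * dist a b)))
    (hB0 : ∀ s a b, |(M s 0)⁻¹ a b| ≤ β₀)
    (hSd : ∑ a, Real.exp (-(θ₂ * d a)) ≤ Sd) (hSdi : ∀ a, ∑ b, Real.exp (-(θ₂ * dist a b)) ≤ Sdist)
    (hR : ∀ s, ∑ a, ∑ b, |(M' s 1 - M' s 0) a b| ≤ η) :
    |Real.log (M 0 0).det - Real.log (M 1 0).det - (Real.log (M 0 1).det - Real.log (M 1 1).det)|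
      ≤ α * ε * β₀ * δ * Sd * Sdist * Real.exp (-((θ - θ₂) * R)) + β₀ * η := by
  have h1 := log_det_sub_eq_integral_trace (M := fun s => M s 1) (M' := fun s => M' s 1) (hM 1) (hM'c 1) (fun s => hne s 1)
  have h0 := log_det_sub_eq_integral_trace (M := fun s => M s 0) (M' := fun s => M' s 0) (hM 0) (hM'c 0) (fun s => hne s 0)
  have hcont : ∀ t, Continuous fun s => ((M s t)⁻¹ * M' s t).trace := by
    intro t
    have hMc : Continuous fun s => M s t :=
      continuous_matrix fun i j => continuous_iff_continuousAt.2 fun s => (hM t s i j).continuousAt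
    have hinv : Continuous fun s => (M s t)⁻¹ := by
      refine continuous_iff_continuousAt.2 fun s => ?_
      have h : ContinuousAt Ring.inverse (M s t).det := by
        rw [Ring.inverse_eq_inv']
        exact continuousAt_inv₀ (hne s t)
      exact ContinuousAt.comp (f := fun s => M s t) (g := fun A : Matrix n n ℝ => A⁻¹)
        (continuousAt_matrix_inv (M s t) h) hMc.continuousAt
    exact (hinv.mul (continuous_matrix (hM'c t))).matrix_trace
  have hrw : Real.log (M 0 0).det - Real.log (M 1 0).det - (Real.log (M 0 1).det - Real.log (M 1 1).det) =
      ∫ s in (0 : ℝ)..1, (((M s 1)⁻¹ * M' s 1).trace - ((M s 0)⁻¹ * M' s 0).trace) := by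
    rw [intervalIntegral.integral_sub ((hcont 1).intervalIntegrable _ _) ((hcont 0).intervalIntegrable _ _)]
    beta_reduce at h1 h0
    linarith
  rw [hrw]
  have hpt : ∀ s, |((M s 1)⁻¹ * M' s 1).trace - ((M s 0)⁻¹ * M' s 0).trace| ≤
      α * ε * β₀ * δ * Sd * Sdist * Real.exp (-((θ - θ₂) * R)) + β₀ * η := by
    intro s
    rw [trace_inv_mul_sub_trace_inv_mul (hne s 0) (hne s 1)]
    refine (abs_add_le _ _).trans (add_le_add ?_ ?_)
    · rw [abs_neg]
      exact abs_trace_mul4_le_of_summedProfiles dist hα hε hβ₀ hδ hθ₂ hθ₂θ hSdist0 (hA s) (hB0 s) (hD s) (hE s) hsep hSd hSdi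
    · exact abs_trace_mul_le_of_entry_le_of_sum_le hβ₀ (hB0 s) (hR s)
  have hbd := intervalIntegral.norm_integral_le_of_norm_le_const (a := (0 : ℝ)) (b := 1)
    (f := fun s => ((M s 1)⁻¹ * M' s 1).trace - ((M s 0)⁻¹ * M' s 0).trace)
    (C := α * ε * β₀ * δ * Sd * Sdist * Real.exp (-((θ - θ₂) * R)) + β₀ * η)
    (fun s _ => by rw [Real.norm_eq_abs]; exact hpt s)
  rw [Real.norm_eq_abs, sub_zero, abs_one, mul_one] at hbd
  exact hbd

/-! ## §3 From pointwise profiles and a finite range to summed profiles -/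

omit [DecidableEq n] in
/-- A function supported where `p` holds and bounded by `c` in absolute value has `Σ_x |f x| ≤ #{x | p x}·c` (private helper). [folklore] -/
private theorem sum_abs_le_card_mul_of_support {f : n → ℝ} {p : n → Prop} [DecidablePred p] {c : ℝ}
    (hsupp : ∀ x, f x ≠ 0 → p x) (hb : ∀ x, |f x| ≤ c) :
    ∑ x, |f x| ≤ (univ.filter p).card * c := by
  classical
  have hsplit : ∑ x, |f x| = ∑ x ∈ univ.filter p, |f x| := by
    refine (Finset.sum_subset (Finset.filter_subset _ _) fun x _ hx => ?_).symm
    have : ¬ p x := by simpa [Finset.mem_filter] using hx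
    have hf : f x = 0 := by
      by_contra h
      exact this (hsupp x h)
    rw [hf, abs_zero]
  rw [hsplit]
  calc ∑ x ∈ univ.filter p, |f x| ≤ ∑ _x ∈ univ.filter p, c := Finset.sum_le_sum fun x _ => hb x
    _ = (univ.filter p).card * c := by rw [Finset.sum_const, nsmul_eq_mul]

/-- ★ **THE CARD-FREE BOUND FROM THE PREQUEL'S POINTWISE ROWS + FINITE RANGE.**  Same rectangle as
`abs_fourPt_log_det_le_of_expLocalised` (pointwise profile rows `|M′(s,1) x a| ≤ δ·e^{−θ·d a}`, `|(M(s,1) − M(s,0)) b c| ≤ ε·e^{−θ·d′ b}`,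
Combes–Thomas decay of `M(s,1)⁻¹`, `|M(s,0)⁻¹| ≤ β₀`), plus: both variations have RANGE `r` for `dist` (`M′(s,1) x a ≠ 0 → dist x a ≤ r`,
`(M(s,1) − M(s,0)) b c ≠ 0 → dist b c ≤ r`), every `dist`-ball of radius `r` (in either slot) has at most `V` points, the mixed response is
ℓ¹-bounded (`Σ_{a,b} |(M′(s,1) − M′(s,0)) a b| ≤ η`), and the local sums `S_d`, `S_dist` at a rate `0 ≤ θ₂ ≤ θ`.  Then
`|Δ² log det| ≤ α·(ε·V)·β₀·(δ·V)·S_d·S_dist·e^{−(θ−θ₂)·R} + β₀·η`. [cite: Balaban1985Variational, Thm 1 (10) p. 279] [cite: GlimmJaffe1987, §18.2] -/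
theorem abs_fourPt_log_det_le_of_expLocalised_range (dist : n → n → ℕ) {M M' : ℝ → ℝ → Matrix n n ℝ}
    (hM : ∀ t s i j, HasDerivAt (fun s => M s t i j) (M' s t i j) s) (hM'c : ∀ t i j, Continuous fun s => M' s t i j)
    (hne : ∀ s t, (M s t).det ≠ 0)
    {α ε δ β₀ η θ θ₂ Sd Sdist : ℝ} (hα : 0 ≤ α) (hε : 0 ≤ ε) (hδ : 0 ≤ δ) (hβ₀ : 0 ≤ β₀)
    (hθ₂ : 0 ≤ θ₂) (hθ₂θ : θ₂ ≤ θ) (hSdist0 : 0 ≤ Sdist)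
    {d d' : n → ℕ} (hD : ∀ s x a, |M' s 1 x a| ≤ δ * Real.exp (-(θ * d a)))
    (hE : ∀ s b c, |(M s 1 - M s 0) b c| ≤ ε * Real.exp (-(θ * d' b)))
    {r : ℕ} (hDr : ∀ s x a, M' s 1 x a ≠ 0 → dist x a ≤ r) (hEr : ∀ s b c, (M s 1 - M s 0) b c ≠ 0 → dist b c ≤ r)
    {V : ℕ} (hVcol : ∀ a, (univ.filter fun x => dist x a ≤ r).card ≤ V) (hVrow : ∀ b, (univ.filter fun c => dist b c ≤ r).card ≤ V)
    {R : ℕ} (hsep : ∀ a b, R ≤ d a + dist a b + d' b)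
    (hA : ∀ s a b, |(M s 1)⁻¹ a b| ≤ α * Real.exp (-(θ * dist a b)))
    (hB0 : ∀ s a b, |(M s 0)⁻¹ a b| ≤ β₀)
    (hSd : ∑ a, Real.exp (-(θ₂ * d a)) ≤ Sd) (hSdi : ∀ a, ∑ b, Real.exp (-(θ₂ * dist a b)) ≤ Sdist)
    (hR : ∀ s, ∑ a, ∑ b, |(M' s 1 - M' s 0) a b| ≤ η) :
    |Real.log (M 0 0).det - Real.log (M 1 0).det - (Real.log (M 0 1).det - Real.log (M 1 1).det)|
      ≤ α * (ε * V) * β₀ * (δ * V) * Sd * Sdist * Real.exp (-((θ - θ₂) * R)) + β₀ * η := by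
  have hV0 : (0 : ℝ) ≤ V := Nat.cast_nonneg _
  -- summed column profile of the `s`-variation
  have hD' : ∀ s a, ∑ x, |M' s 1 x a| ≤ δ * V * Real.exp (-(θ * d a)) := by
    intro s a
    have h0 : 0 ≤ δ * Real.exp (-(θ * d a)) := by positivity
    have h := sum_abs_le_card_mul_of_support (f := fun x => M' s 1 x a) (p := fun x => dist x a ≤ r)
      (fun x hx => hDr s x a hx) (fun x => hD s x a)
    calc ∑ x, |M' s 1 x a| ≤ ((univ.filter fun x => dist x a ≤ r).card : ℝ) * (δ * Real.exp (-(θ * d a))) := h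
      _ ≤ (V : ℝ) * (δ * Real.exp (-(θ * d a))) := by
          have hc : ((univ.filter fun x => dist x a ≤ r).card : ℝ) ≤ V := by exact_mod_cast hVcol a
          exact mul_le_mul_of_nonneg_right hc h0
      _ = δ * V * Real.exp (-(θ * d a)) := by ring
  -- summed row profile of the `t`-variation
  have hE' : ∀ s b, ∑ c, |(M s 1 - M s 0) b c| ≤ ε * V * Real.exp (-(θ * d' b)) := by
    intro s b
    have h0 : 0 ≤ ε * Real.exp (-(θ * d' b)) := by positivity
    have h := sum_abs_le_card_mul_of_support (f := fun c => (M s 1 - M s 0) b c) (p := fun c => dist b c ≤ r)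
      (fun c hc => hEr s b c hc) (fun c => hE s b c)
    calc ∑ c, |(M s 1 - M s 0) b c| ≤ ((univ.filter fun c => dist b c ≤ r).card : ℝ) * (ε * Real.exp (-(θ * d' b))) := h
      _ ≤ (V : ℝ) * (ε * Real.exp (-(θ * d' b))) := by
          have hc : ((univ.filter fun c => dist b c ≤ r).card : ℝ) ≤ V := by exact_mod_cast hVrow b
          exact mul_le_mul_of_nonneg_right hc h0
      _ = ε * V * Real.exp (-(θ * d' b)) := by ring
  have h := abs_fourPt_log_det_le_of_summedProfiles dist hM hM'c hne hα (mul_nonneg hε hV0) (mul_nonneg hδ hV0) hβ₀ hθ₂ hθ₂θ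
    hSdist0 hD' hE' hsep hA hB0 hSd hSdi hR
  calc |Real.log (M 0 0).det - Real.log (M 1 0).det - (Real.log (M 0 1).det - Real.log (M 1 1).det)|
      ≤ α * (ε * V) * β₀ * (δ * V) * Sd * Sdist * Real.exp (-((θ - θ₂) * R)) + β₀ * η := h

/-! ## §4 The ℓ¹ mixed-response row from a two-profile pointwise row, and the all-pointwise card-free rectangle -/

omit [DecidableEq n] in
/-- ★ **ℓ¹ bound from a TWO-PROFILE pointwise row + finite range.**  If `|H a b| ≤ η₀·e^{−θ·(d a + d′ a)}` (localised near BOTH profiles —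
the mixed response of a background to two distant moves), `H a b ≠ 0 → dist a b ≤ r`, every `dist`-ball `{b | dist a b ≤ r}` has at most `V`
points, the two profiles are `R` apart AT EVERY INDEX (`R ≤ d a + d′ a`), and `Σ_a e^{−θ₂·d a} ≤ S_d` for some `0 ≤ θ₂ ≤ θ`, then
`Σ_a Σ_b |H a b| ≤ η₀·V·S_d·e^{−(θ−θ₂)·R}`. [cite: AizenmanWarzel2015, §10.3] [cite: HornJohnson2013, §5.6] -/
theorem sum_sum_abs_le_of_twoProfile_range (dist : n → n → ℕ) {H : Matrix n n ℝ} {η₀ θ θ₂ Sd : ℝ}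
    (hη₀ : 0 ≤ η₀) (hθ₂ : 0 ≤ θ₂) (hθ₂θ : θ₂ ≤ θ)
    {d d' : n → ℕ} (hH : ∀ a b, |H a b| ≤ η₀ * Real.exp (-(θ * (d a + d' a))))
    {r : ℕ} (hHr : ∀ a b, H a b ≠ 0 → dist a b ≤ r) {V : ℕ} (hV : ∀ a, (univ.filter fun b => dist a b ≤ r).card ≤ V)
    {R : ℕ} (hsep : ∀ a, R ≤ d a + d' a) (hSd : ∑ a, Real.exp (-(θ₂ * d a)) ≤ Sd) :
    ∑ a, ∑ b, |H a b| ≤ η₀ * V * Sd * Real.exp (-((θ - θ₂) * R)) := by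
  have hV0 : (0 : ℝ) ≤ V := Nat.cast_nonneg _
  have hexp : ∀ a, Real.exp (-(θ * (d a + d' a))) ≤ Real.exp (-((θ - θ₂) * R)) * Real.exp (-(θ₂ * d a)) := by
    intro a
    rw [← Real.exp_add]
    refine Real.exp_le_exp.2 ?_
    have h : (R : ℝ) ≤ d a + d' a := by exact_mod_cast hsep a
    have h1 : (0 : ℝ) ≤ d' a := Nat.cast_nonneg _
    have h2 : (0 : ℝ) ≤ d a := Nat.cast_nonneg _
    have h4 : 0 ≤ θ - θ₂ := sub_nonneg.2 hθ₂θ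
    nlinarith [mul_le_mul_of_nonneg_left h h4, mul_nonneg hθ₂ h1]
  have hrow : ∀ a, ∑ b, |H a b| ≤ η₀ * V * Real.exp (-((θ - θ₂) * R)) * Real.exp (-(θ₂ * d a)) := by
    intro a
    have h0 : 0 ≤ η₀ * Real.exp (-(θ * (d a + d' a))) := by positivity
    have h := sum_abs_le_card_mul_of_support (f := fun b => H a b) (p := fun b => dist a b ≤ r)
      (fun b hb => hHr a b hb) (fun b => hH a b)
    calc ∑ b, |H a b| ≤ ((univ.filter fun b => dist a b ≤ r).card : ℝ) * (η₀ * Real.exp (-(θ * (d a + d' a)))) := h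
      _ ≤ (V : ℝ) * (η₀ * Real.exp (-(θ * (d a + d' a)))) := by
          have hc : ((univ.filter fun b => dist a b ≤ r).card : ℝ) ≤ V := by exact_mod_cast hV a
          exact mul_le_mul_of_nonneg_right hc h0
      _ ≤ (V : ℝ) * (η₀ * (Real.exp (-((θ - θ₂) * R)) * Real.exp (-(θ₂ * d a)))) :=
          mul_le_mul_of_nonneg_left (mul_le_mul_of_nonneg_left (hexp a) hη₀) hV0
      _ = η₀ * V * Real.exp (-((θ - θ₂) * R)) * Real.exp (-(θ₂ * d a)) := by ring
  calc ∑ a, ∑ b, |H a b| ≤ ∑ a, η₀ * V * Real.exp (-((θ - θ₂) * R)) * Real.exp (-(θ₂ * d a)) :=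
        Finset.sum_le_sum fun a _ => hrow a
    _ = η₀ * V * Real.exp (-((θ - θ₂) * R)) * ∑ a, Real.exp (-(θ₂ * d a)) := by rw [Finset.mul_sum]
    _ ≤ η₀ * V * Real.exp (-((θ - θ₂) * R)) * Sd := mul_le_mul_of_nonneg_left hSd (by positivity)
    _ = η₀ * V * Sd * Real.exp (-((θ - θ₂) * R)) := by ring

/-- ★★ **THE ALL-POINTWISE CARD-FREE RECTANGLE.**  As `abs_fourPt_log_det_le_of_expLocalised_range`, with the ℓ¹ mixed-response hypothesis
replaced by the TWO-PROFILE pointwise row `|(M′(s,1) − M′(s,0)) a b| ≤ η₀·e^{−θ·(d a + d′ a)}` (the mixed response of the background to the two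
moves is localised near both bonds), its range `r`, and the separation `R ≤ d a + d′ a` at every index:
`|Δ² log det| ≤ α·(ε·V)·β₀·(δ·V)·S_d·S_dist·e^{−(θ−θ₂)·R} + β₀·(η₀·V·S_d·e^{−(θ−θ₂)·R})` — every row pointwise, every constant local,
no `Fintype.card n`. [cite: Balaban1985Variational, Thm 1 (10) p. 279] [cite: GlimmJaffe1987, §18.2] -/
theorem abs_fourPt_log_det_le_of_expLocalised_range₂ (dist : n → n → ℕ) {M M' : ℝ → ℝ → Matrix n n ℝ}
    (hM : ∀ t s i j, HasDerivAt (fun s => M s t i j) (M' s t i j) s) (hM'c : ∀ t i j, Continuous fun s => M' s t i j)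
    (hne : ∀ s t, (M s t).det ≠ 0)
    {α ε δ β₀ η₀ θ θ₂ Sd Sdist : ℝ} (hα : 0 ≤ α) (hε : 0 ≤ ε) (hδ : 0 ≤ δ) (hβ₀ : 0 ≤ β₀) (hη₀ : 0 ≤ η₀)
    (hθ₂ : 0 ≤ θ₂) (hθ₂θ : θ₂ ≤ θ) (hSdist0 : 0 ≤ Sdist)
    {d d' : n → ℕ} (hD : ∀ s x a, |M' s 1 x a| ≤ δ * Real.exp (-(θ * d a)))
    (hE : ∀ s b c, |(M s 1 - M s 0) b c| ≤ ε * Real.exp (-(θ * d' b)))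
    (hR : ∀ s a b, |(M' s 1 - M' s 0) a b| ≤ η₀ * Real.exp (-(θ * (d a + d' a))))
    {r : ℕ} (hDr : ∀ s x a, M' s 1 x a ≠ 0 → dist x a ≤ r) (hEr : ∀ s b c, (M s 1 - M s 0) b c ≠ 0 → dist b c ≤ r)
    (hRr : ∀ s a b, (M' s 1 - M' s 0) a b ≠ 0 → dist a b ≤ r)
    {V : ℕ} (hVcol : ∀ a, (univ.filter fun x => dist x a ≤ r).card ≤ V) (hVrow : ∀ b, (univ.filter fun c => dist b c ≤ r).card ≤ V)
    {R : ℕ} (hsep : ∀ a b, R ≤ d a + dist a b + d' b) (hsep₂ : ∀ a, R ≤ d a + d' a)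
    (hA : ∀ s a b, |(M s 1)⁻¹ a b| ≤ α * Real.exp (-(θ * dist a b)))
    (hB0 : ∀ s a b, |(M s 0)⁻¹ a b| ≤ β₀)
    (hSd : ∑ a, Real.exp (-(θ₂ * d a)) ≤ Sd) (hSdi : ∀ a, ∑ b, Real.exp (-(θ₂ * dist a b)) ≤ Sdist) :
    |Real.log (M 0 0).det - Real.log (M 1 0).det - (Real.log (M 0 1).det - Real.log (M 1 1).det)|
      ≤ α * (ε * V) * β₀ * (δ * V) * Sd * Sdist * Real.exp (-((θ - θ₂) * R)) +
          β₀ * (η₀ * V * Sd * Real.exp (-((θ - θ₂) * R))) :=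
  abs_fourPt_log_det_le_of_expLocalised_range dist hM hM'c hne hα hε hδ hβ₀ hθ₂ hθ₂θ hSdist0 hD hE hDr hEr hVcol hVrow hsep hA hB0
    hSd hSdi fun s => sum_sum_abs_le_of_twoProfile_range dist hη₀ hθ₂ hθ₂θ (hR s) (hRr s) hVrow hsep₂ hSd

end Literature.Analysis.Matrix

end
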